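import Summits.CriticalPhenomena.PercolationContinuityZ3.Theorems.PercNearOneGluingNoHeavyLowerTailCSHPsiDefs
import Summits.CriticalPhenomena.PercolationContinuityZ3.Theorems.PercNearOneGluingNoHeavyLowerTailHullPortCSHFourPT
import HarnessLib

/-!
# Pinned hierarchy — the set-4PT with a pinned observer ((K6)_ψ) and the base rung PIN-CSH(∅; x; []; ψ, v)

Support file (`--supports stmt-CriticalPhenomena-4575`), route task `nh-dp-fatminority` (gen 15); memo
`run/shared/lean/prim/prim-nh-dp-fatminority/CSH-PSI-MEMO.md` §2 ((E′), (K6)_ψ).  No definitions, no named facts, no sorries.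

* `PinCSH.setFourPT_pin` — (K6)_ψ: for `x ∈ S`, `v`, the pinned test `ψ = 1{o ∈ ·}·1{· ∈ 𝓗}` (`𝓗` upper) and `F ≥ 0` monotone on the open
  edge cluster of `x`:  `μ(D ∩ pinEv o 𝓗 v)·(∫_{v↔S} F − μ(v↔S)∫F) ≤ μ(D)·(∫_{{o↔S} ∩ E} F − μ({o↔S} ∩ E)∫F)`, `D = {v ↮ S}`, `E = {C_o ∈ 𝓗}`.
  Proof = `HullPort.setFourPT_edge` (prim-ineq-prove-5) with the EXCLUSIVITY split (E′) `({o↔S∪v} ∩ E) = ({o↔S} ∩ E) ⊔ (D ∩ pinEv o 𝓗 v)`,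
  Harris for the increasing event `{o↔S∪v} ∩ E`, and van den Berg–Häggström–Kahn's two-set negative correlation given `S ↮ v` with the
  increasing test `1{o ∈ C_v}·1{C_v ∈ 𝓗}` of `C_v`.
* `PinCSH.holds_nil_nil` — THE BASE RUNG of memo Theorem 1_ψ: `PinCSH.Holds w o 𝓗 x ∅ [] v` (no avoided set, no decoys), i.e. the pinned
  four-point inequality `Cov(F(C_x), ψ(C_x)) ≥ μ(ψ(C_v) | v ↮ x)·Cov(F(C_x), 1{v ∈ C_x})`, unconditionally.
[cite: VandenbergHaggstromKahn2005, Thm. 1.4 (p. 7), Thm. 1.5 (p. 7)] [cite: KozmaNitzan2024, Conj. 4 (p. 32)]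
-/

noncomputable section

namespace Summit.CriticalPhenomena.PercolationContinuityZ3.Theorems

open MeasureTheory Set Literature.Probability.LatticeModels Literature.Probability.Percolation
open scoped Classical
open KNPreFKG BHK2006 DecisionTree

namespace PinCSH

variable {V : Type*} [Fintype V]

/-- **Set-4PT with a pinned observer ((K6)_ψ of the memo).**  For `x ∈ S`, `F` monotone nonnegative on the open edge cluster of `x`,
`𝓗` an upper family, `E = {C_o ∈ 𝓗}`, `D = {v ↮ S}`:
`μ(D ∩ pinEv o 𝓗 v)·(∫_{v↔S} F − μ(v↔S)∫F) ≤ μ(D)·(∫_{{o↔S}∩E} F − μ({o↔S}∩E)∫F)`.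
(transcription of the memo prim-nh-dp-fatminority CSH-PSI-MEMO.md §2 (K6)_ψ) [cite: VandenbergHaggstromKahn2005, Thm. 1.5 (p. 7)] -/
theorem setFourPT_pin (w : Sym2 V → unitInterval) (S : Set V) (o v x : V) (hx : x ∈ S) (𝓗 : Set (Set (Sym2 V)))
    (h𝓗 : IsUpperSet 𝓗) (F : Set (Sym2 V) → ℝ) (hF : Monotone F) (hF0 : ∀ C, 0 ≤ F C) :
    (prodBernoulli w).real ({ω : BondConfig V | ∀ s ∈ S, ¬ (openGraph ω).Reachable s v} ∩ pinEv o 𝓗 v) *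
        (∫ ω in {ω : BondConfig V | ∃ s ∈ S, (openGraph ω).Reachable s v}, F (openEdgeCluster ω x) ∂(prodBernoulli w) -
          (prodBernoulli w).real {ω : BondConfig V | ∃ s ∈ S, (openGraph ω).Reachable s v} *
            ∫ ω, F (openEdgeCluster ω x) ∂(prodBernoulli w)) ≤
      (prodBernoulli w).real {ω : BondConfig V | ∀ s ∈ S, ¬ (openGraph ω).Reachable s v} *
        (∫ ω in {ω : BondConfig V | ∃ s ∈ S, (openGraph ω).Reachable s o} ∩ {ω | openEdgeCluster ω o ∈ 𝓗},
            F (openEdgeCluster ω x) ∂(prodBernoulli w) -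
          (prodBernoulli w).real ({ω : BondConfig V | ∃ s ∈ S, (openGraph ω).Reachable s o} ∩ {ω | openEdgeCluster ω o ∈ 𝓗}) *
            ∫ ω, F (openEdgeCluster ω x) ∂(prodBernoulli w)) := by
  set μ := prodBernoulli w with hμ
  have hmeas : ∀ A : Set (BondConfig V), MeasurableSet A := fun _ => MeasurableSet.of_discrete
  set f : BondConfig V → ℝ := fun ω => F (openEdgeCluster ω x) with hf
  have hfmono : Monotone f := fun ω ω' h => hF (openEdgeCluster_mono h x)
  have hf0 : ∀ ω, 0 ≤ f ω := fun ω => hF0 _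
  have hint : ∀ A : Set (BondConfig V), IntegrableOn f A μ := fun A => (Integrable.of_finite).integrableOn
  set D : Set (BondConfig V) := {ω | ∀ s ∈ S, ¬ (openGraph ω).Reachable s v} with hD
  set Eo : Set (BondConfig V) := {ω | openEdgeCluster ω o ∈ 𝓗} with hEo
  set OS : Set (BondConfig V) := {ω | ∃ s ∈ S, (openGraph ω).Reachable s o} ∩ Eo with hOS
  set VS : Set (BondConfig V) := {ω | ∃ s ∈ S, (openGraph ω).Reachable s v} with hVS
  set Ov : Set (BondConfig V) := pinEv o 𝓗 v with hOv
  -- the exclusivity split (E′): `({o ↔ S ∪ {v}} ∩ E) = OS ⊔ (Ov ∩ D)`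
  set U : Set (BondConfig V) := OS ∪ Ov with hU
  have hdisj : Disjoint OS (Ov ∩ D) := by
    rw [Set.disjoint_left]
    rintro ω ⟨⟨s, hs, hso⟩, -⟩ ⟨hov, hD'⟩
    exact hD' s hs (hso.trans (show (openGraph ω).Reachable v o from hov.1).symm)
  have hUeq : U = OS ∪ (Ov ∩ D) := by
    ext ω; simp only [hU, Set.mem_union, Set.mem_inter_iff]
    constructor
    · rintro (h | h)
      · exact Or.inl h
      · by_cases hD' : ω ∈ D
        · exact Or.inr ⟨h, hD'⟩
        · left
          simp only [hD, Set.mem_setOf_eq, not_forall, not_not] at hD'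
          obtain ⟨s, hs, hsv⟩ := hD'
          refine ⟨⟨s, hs, hsv.trans (show (openGraph ω).Reachable v o from h.1)⟩, ?_⟩
          show openEdgeCluster ω o ∈ 𝓗
          rw [← attachSet_openEdgeCluster_eq_of_reachable (show (openGraph ω).Reachable v o from h.1)]
          exact h.2
    · rintro (h | ⟨h, -⟩)
      · exact Or.inl h
      · exact Or.inr h
  have hVD : VS = Dᶜ := by
    ext ω; simp only [hVS, hD, Set.mem_setOf_eq, Set.mem_compl_iff, not_forall, not_not]
    exact ⟨fun ⟨s, hs, h⟩ => ⟨s, hs, h⟩, fun ⟨s, hs, h⟩ => ⟨s, hs, h⟩⟩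
  -- (1) Harris on the increasing event `U = {o ↔ S ∪ {v}} ∩ E`
  have hupEo : IsUpperSet Eo := fun ω ω' hle hω => h𝓗 (openEdgeCluster_mono hle o) hω
  have hupOS : IsUpperSet OS := by
    refine IsUpperSet.inter ?_ hupEo
    intro ω ω' hle hω
    obtain ⟨s, hs, h⟩ := hω
    exact ⟨s, hs, h.mono (openGraph_le hle)⟩
  have hupOv : IsUpperSet Ov := fun ω ω' hle hω => pinEv_mono h𝓗 v hle hω
  have hupU : IsUpperSet U := hupOS.union hupOv
  have harris : (∫ ω, f ω ∂μ) * μ.real U ≤ ∫ ω in U, f ω ∂μ := by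
    have h := HullPort.integral_harris w f (U.indicator 1) hfmono (monotone_indicator_one_of_isUpperSet hupU) hf0
      (fun ω => Set.indicator_nonneg (fun _ _ => zero_le_one) _)
    rw [integral_indicator_one (hmeas _)] at h
    have e : ∫ ω, f ω * U.indicator 1 ω ∂μ = ∫ ω in U, f ω ∂μ := by
      rw [← integral_indicator (hmeas _)]
      refine integral_congr_ae (Filter.Eventually.of_forall fun ω => ?_)
      by_cases hω : ω ∈ U
      · simp [Set.indicator_of_mem hω]
      · simp [Set.indicator_of_notMem hω]
    rw [e] at h; exact h
  -- (2) two-set negative correlation given `{S ↮ v}` with the pinned test of `C_v`:  `μ(D) ∫_{D ∩ Ov} f ≤ (∫_D f) μ(D ∩ Ov)`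
  have hDeq : {ω : BondConfig V | ∀ s ∈ S, ∀ t ∈ ({v} : Set V), ¬ (openGraph ω).Reachable s t} = D := by
    ext ω; simp only [hD, Set.mem_setOf_eq, Set.mem_singleton_iff, forall_eq]
  set 𝒰 : Set (Set (Sym2 V)) := {K : Set (Sym2 V) | (o = v ∨ ∃ e ∈ K, o ∈ e) ∧ K ∈ 𝓗} with h𝒰
  have h𝒰mono : ∀ C C' : Set (Sym2 V), C ⊆ C' → ind 𝒰 C ≤ ind 𝒰 C' := by
    intro C C' h
    by_cases hC : C ∈ 𝒰
    · rw [ind_of_mem hC, ind_of_mem (show C' ∈ 𝒰 from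
        ⟨hC.1.elim Or.inl fun ⟨e, he, hoe⟩ => Or.inr ⟨e, h he, hoe⟩, h𝓗 h hC.2⟩)]
    · rw [ind_of_not_mem hC]; exact ind_nonneg _ _
  have neg := BHK2006_twoSetConditionalAssociation.negCorrelation w S ({v} : Set V)
    (fun C => F (openEdgeCluster C x)) (fun C => ind 𝒰 C)
    (fun C C' h => hF (openEdgeCluster_mono h x)) h𝒰mono
  rw [hDeq] at neg
  have e1 : ∀ ω, F (openEdgeCluster (⋃ s ∈ S, openEdgeCluster ω s) x) = f ω := fun ω => by
    simp only [hf]; rw [HullPort.openEdgeCluster_biUnion_eq ω S hx]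
  have e2 : ∀ ω, ind 𝒰 (⋃ t ∈ ({v} : Set V), openEdgeCluster ω t) = Ov.indicator 1 ω := by
    intro ω
    have hunion : (⋃ t ∈ ({v} : Set V), openEdgeCluster ω t) = openEdgeCluster ω v := by
      ext e; simp
    rw [hunion]
    by_cases h : ω ∈ Ov
    · rw [ind_of_mem (show openEdgeCluster ω v ∈ 𝒰 from
        ⟨(reachable_iff_exists_mem_openEdgeCluster ω v o).1 h.1, h.2⟩), Set.indicator_of_mem h, Pi.one_apply]
    · rw [ind_of_not_mem (show openEdgeCluster ω v ∉ 𝒰 from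
        fun hh => h ⟨(reachable_iff_exists_mem_openEdgeCluster ω v o).2 hh.1, hh.2⟩), Set.indicator_of_notMem h]
  simp only [e1, e2] at neg
  have i1 : ∫ ω in D, f ω * Ov.indicator 1 ω ∂μ = ∫ ω in Ov ∩ D, f ω ∂μ := by
    have e : (fun ω => f ω * Ov.indicator (1 : BondConfig V → ℝ) ω) = Ov.indicator f := by
      funext ω
      by_cases hω : ω ∈ Ov
      · rw [Set.indicator_of_mem hω, Set.indicator_of_mem hω, Pi.one_apply, mul_one]
      · rw [Set.indicator_of_notMem hω, Set.indicator_of_notMem hω, mul_zero]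
    rw [e, setIntegral_indicator (hmeas Ov), Set.inter_comm]
  have i2 : ∫ ω in D, Ov.indicator (1 : BondConfig V → ℝ) ω ∂μ = μ.real (Ov ∩ D) := by
    rw [setIntegral_indicator (hmeas Ov), Set.inter_comm]
    simp only [Pi.one_apply]
    rw [setIntegral_const, smul_eq_mul, mul_one]
  rw [← hμ] at neg
  rw [i1, i2] at neg
  -- bookkeeping (verbatim `HullPort.setFourPT_edge`)
  have iU : ∫ ω in U, f ω ∂μ = (∫ ω in OS, f ω ∂μ) + ∫ ω in Ov ∩ D, f ω ∂μ := by
    rw [hUeq]; exact setIntegral_union hdisj (hmeas _) (hint _) (hint _)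
  have mU : μ.real U = μ.real OS + μ.real (Ov ∩ D) := by
    rw [hUeq]; exact measureReal_union hdisj (hmeas _)
  have iV : ∫ ω in VS, f ω ∂μ = (∫ ω, f ω ∂μ) - ∫ ω in D, f ω ∂μ := by
    have := integral_add_compl (hmeas D) (Integrable.of_finite (f := f) (μ := μ))
    rw [hVD]; linarith
  have mV : μ.real VS = 1 - μ.real D := by
    have := measureReal_add_measureReal_compl (μ := μ) (hmeas D)
    rw [probReal_univ] at this
    rw [hVD]; linarith
  have mc : μ.real (D ∩ Ov) = μ.real (Ov ∩ D) := by rw [Set.inter_comm]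
  rw [mc, iV, mV]
  have hD0 : 0 ≤ μ.real D := measureReal_nonneg
  have H0 : 0 ≤ (∫ ω in OS, f ω ∂μ) - ((∫ ω, f ω ∂μ) * μ.real U - ∫ ω in Ov ∩ D, f ω ∂μ) := by linarith
  have key : μ.real D * ((∫ ω in OS, f ω ∂μ) - μ.real OS * ∫ ω, f ω ∂μ) -
      μ.real (Ov ∩ D) * (((∫ ω, f ω ∂μ) - ∫ ω in D, f ω ∂μ) - (1 - μ.real D) * ∫ ω, f ω ∂μ) =
      μ.real D * ((∫ ω in OS, f ω ∂μ) - ((∫ ω, f ω ∂μ) * μ.real U - ∫ ω in Ov ∩ D, f ω ∂μ)) +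
        ((∫ ω in D, f ω ∂μ) * μ.real (Ov ∩ D) - μ.real D * ∫ ω in Ov ∩ D, f ω ∂μ) := by
    rw [mU]; ring
  nlinarith [mul_nonneg hD0 H0, neg, key]

/-- **The base rung of the pinned hierarchy (memo Theorem 1_ψ at `Y = ∅`, `D = []`), unconditionally**: for the label `o`, any upper family
`𝓗`, owner `x` and second observer `v ≠ o`, `PinCSH.Holds w o 𝓗 x ∅ [] v`, i.e. the pinned four-point inequality
`Cov(F(C_x), ψ(C_x)) ≥ μ(ψ(C_v) | v ↮ x)·Cov(F(C_x), 1{x ↔ v})` for every monotone `F` (shift to `F − F ∅ ≥ 0`, then `setFourPT_pin` with `S = {x}`).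
(transcription of the memo prim-nh-dp-fatminority CSH-PSI-MEMO.md §2) [cite: VandenbergHaggstromKahn2005, Thm. 1.4 (p. 7)] -/
theorem holds_nil_nil (w : Sym2 V → unitInterval) (o : V) (𝓗 : Set (Set (Sym2 V))) (h𝓗 : IsUpperSet 𝓗) (x v : V) (hvo : v ≠ o) :
    Holds w o 𝓗 x ∅ [] v := by
  intro F hF
  have hmeas : ∀ A : Set (BondConfig V), MeasurableSet A := fun _ => MeasurableSet.of_discrete
  -- shift `F` to a nonnegative monotone functional; the margin is shift-invariant
  set F0 : Set (Sym2 V) → ℝ := fun C => F C - F ∅ with hF0def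
  have hF0 : Monotone F0 := fun C C' h => sub_le_sub_right (hF h) _
  have hF00 : ∀ C, 0 ≤ F0 C := fun C => sub_nonneg.2 (hF (empty_subset C))
  have key := setFourPT_pin w ({x} : Set V) o v x (mem_singleton x) 𝓗 h𝓗 F0 hF0 hF00
  -- rewrite the sets of `key` into those of the margin
  set Dv : Set (BondConfig V) := {ω : BondConfig V | ∀ a ∈ insert x (∅ : Set V), ¬ (openGraph ω).Reachable v a} with hDv
  have hS1 : {ω : BondConfig V | ∀ s ∈ ({x} : Set V), ¬ (openGraph ω).Reachable s v} = Dv := by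
    ext ω
    simp only [hDv, mem_setOf_eq, mem_singleton_iff, forall_eq, insert_empty_eq]
    exact ⟨fun h h' => h h'.symm, fun h h' => h h'.symm⟩
  have hS2 : {ω : BondConfig V | ∃ s ∈ ({x} : Set V), (openGraph ω).Reachable s v} = (openConn x v : Set (BondConfig V)) := by
    ext ω; simp only [mem_setOf_eq, mem_singleton_iff, exists_eq_left]; rfl
  have hS3 : {ω : BondConfig V | ∃ s ∈ ({x} : Set V), (openGraph ω).Reachable s o} ∩ {ω | openEdgeCluster ω o ∈ 𝓗} = pinEv o 𝓗 x := by
    rw [pinEv_eq_inter_event]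
    ext ω; simp only [mem_inter_iff, mem_setOf_eq, mem_singleton_iff, exists_eq_left]; rfl
  rw [hS1, hS2, hS3] at key
  -- shift invariance of the two covariances
  have hshift : ∀ A : Set (BondConfig V),
      (∫ ω in A, F0 (openEdgeCluster ω x) ∂(prodBernoulli w)) -
          (prodBernoulli w).real A * ∫ ω, F0 (openEdgeCluster ω x) ∂(prodBernoulli w) =
        (∫ ω in A, F (openEdgeCluster ω x) ∂(prodBernoulli w)) -
          (∫ ω, F (openEdgeCluster ω x) ∂(prodBernoulli w)) * (prodBernoulli w).real A := by
    intro A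
    simp only [hF0def]
    rw [integral_sub (Integrable.of_finite).integrableOn (Integrable.of_finite).integrableOn,
      integral_sub Integrable.of_finite Integrable.of_finite, setIntegral_const, integral_const, smul_eq_mul, smul_eq_mul,
      probReal_univ]
    ring
  rw [hshift, hshift] at key
  -- unfold the (∅, []) margin: `Cov(F, pinEv x) − (μ(Dv ∩ pinEv v)/μ(Dv)) · Cov(F, 1{x↔v})`
  simp only [pMargin, pDecoyList, CSH.cshMarg_nil, pObsConst, pCovD, CSH.covD, if_true, if_neg hvo, List.not_mem_nil, setOf_false,
    union_empty, mem_empty_iff_false, false_implies, implies_true, setOf_true, probReal_univ, Measure.restrict_univ,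
    univ_inter, one_mul]
  set CP : ℝ := (∫ ω in pinEv o 𝓗 x, F (openEdgeCluster ω x) ∂(prodBernoulli w)) -
    (∫ ω, F (openEdgeCluster ω x) ∂(prodBernoulli w)) * (prodBernoulli w).real (pinEv o 𝓗 x) with hCP
  set CV : ℝ := (∫ ω in openConn x v, F (openEdgeCluster ω x) ∂(prodBernoulli w)) -
    (∫ ω, F (openEdgeCluster ω x) ∂(prodBernoulli w)) * (prodBernoulli w).real (openConn x v : Set (BondConfig V)) with hCV
  -- `key : μ(Dv ∩ pinEv v) · CV ≤ μ(Dv) · CP`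
  by_cases hDv0 : (prodBernoulli w).real Dv = 0
  · have h0 : (prodBernoulli w).real (Dv ∩ pinEv o 𝓗 v) = 0 :=
      le_antisymm (le_trans (measureReal_mono inter_subset_left) (le_of_eq hDv0)) measureReal_nonneg
    rw [h0, zero_div, zero_mul, sub_zero]
    -- Harris alone: `Cov(F, pinEv x) ≥ 0`
    have hup : IsUpperSet (pinEv o 𝓗 x) := fun ω ω' hle hω => pinEv_mono h𝓗 x hle hω
    have hfmono : Monotone (fun ω : BondConfig V => F0 (openEdgeCluster ω x)) := fun ω ω' h => hF0 (openEdgeCluster_mono h x)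
    have h := HullPort.integral_harris w (fun ω => F0 (openEdgeCluster ω x)) ((pinEv o 𝓗 x).indicator 1) hfmono
      (monotone_indicator_one_of_isUpperSet hup) (fun ω => hF00 _) (fun ω => Set.indicator_nonneg (fun _ _ => zero_le_one) _)
    rw [integral_indicator_one (hmeas _)] at h
    have e : ∫ ω, F0 (openEdgeCluster ω x) * (pinEv o 𝓗 x).indicator 1 ω ∂(prodBernoulli w) =
        ∫ ω in pinEv o 𝓗 x, F0 (openEdgeCluster ω x) ∂(prodBernoulli w) := by
      rw [← integral_indicator (hmeas _)]
      refine integral_congr_ae (Filter.Eventually.of_forall fun ω => ?_)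
      by_cases hω : ω ∈ pinEv o 𝓗 x
      · simp [Set.indicator_of_mem hω]
      · simp [Set.indicator_of_notMem hω]
    rw [e] at h
    have h2 := hshift (pinEv o 𝓗 x)
    linarith [h, h2]
  · have hDvpos : 0 < (prodBernoulli w).real Dv := lt_of_le_of_ne measureReal_nonneg (Ne.symm hDv0)
    have : (prodBernoulli w).real (Dv ∩ pinEv o 𝓗 v) / (prodBernoulli w).real Dv * CV ≤ CP := by
      rw [div_mul_eq_mul_div, div_le_iff₀ hDvpos]
      linarith [key]
    linarith [this]

end PinCSH

end Summit.CriticalPhenomena.PercolationContinuityZ3.Theorems
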